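import Literature.ModelTheory.ExponentialFields.RealExpTransfer
import Literature.ModelTheory.ExponentialFields.ExpPolyCodeLawful
import Literature.NumberTheory.Transcendental.DerivationExtension
import Literature.NumberTheory.Transcendental.KirbyEDerivations
import Mathlib.Analysis.Complex.Polynomial.Basic
import Mathlib.FieldTheory.Minpoly.Field
import Mathlib.LinearAlgebra.Matrix.Nondegenerate
import Mathlib.Algebra.MvPolynomial.PDeriv
import Mathlib.Algebra.Polynomial.Roots
import Mathlib.RingTheory.Polynomial.UniqueFactorization
import HarnessLib

/-!
# Wilkie 1989, §6: the base case `P₀,ₛ` — non-singular zeros of polynomial systems over `k` lie in `kⁿ`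

Trunk `TranscendEllArithS`, family `periods` (periods.S28): towards the leaf
`Literature.ModelTheory.ExponentialFields.Wilkie1989_expAlgebraicPoints_mem` (`Wilkie1989.lean`; §§5–6 of
A. J. Wilkie, *On the theory of the real exponential field*, Illinois J. Math. 33 (1989)) of the
decomposition of the named fact `Literature.ModelTheory.ExponentialFields.wilkie_isModelComplete`.

§6 of the paper (p. 403) proves, by induction on `(j, s) ∈ ℕ²` ordered lexicographically, the
statements

> `P_{j,s}`: Suppose `n ∈ ℕ`, `n ≥ 1`, `ᾱ ∈ Kⁿ`, `x̄ = x₁, …, xₙ` and `M ⊆ k[x̄]ᵉ` has height `≤ j`.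
> Suppose `g₁, …, gₙ ∈ M` all have degree `≤ s` (in `M`) (in the case `j ≥ 1`). If
> `ᾱ ∈ Vⁿˢ(g₁, …, gₙ)` then `ᾱ ∈ kⁿ`,

and disposes of the base case in one sentence: "For all `s ∈ ℕ`, `P_{0,s}` is clear since it is
well known that the coordinates of an `ᾱ ∈ Vⁿˢ(g₁, …, gₙ)`, where `g₁, …, gₙ ∈ k[x̄]`, are algebraic
over `k`, and `k`, `K` are real-closed fields (being models of `Tₑ`)."  (Height `0` means
`M ⊆ k[x̄]`, the polynomial ring, p. 395.)  This file **proves** that sentence: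

* `Literature.ModelTheory.ExponentialFields.isAlgebraic_of_isNonsingularZero` (**the coordinates of a
  non-singular zero of a square polynomial system are algebraic over the coefficient field**,
  characteristic `0`): if `P₁, …, Pₙ ∈ k[X₁, …, Xₙ]` vanish at `ᾱ ∈ Kⁿ` with
  `det (∂Pᵢ/∂Xⱼ(ᾱ)) ≠ 0` then every `αⱼ` is algebraic over `k`.  Proof by derivations: a
  `k`-derivation `D` of `K` kills each `Pᵢ(ᾱ)`, so the vector `(D αⱼ)ⱼ` is in the kernel of the
  Jacobian, hence zero; but a transcendental `αⱼ` admits `D` with `D αⱼ = 1`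
  (`Literature.NumberTheory.Transcendental.exists_derivation_eq_one_of_transcendental`; the chain
  rule is the tree's `Literature.NumberTheory.Transcendental.derivation_mvPolynomial_aeval`).
* `Literature.ModelTheory.ExponentialFields.RealExpModel.natDegree_le_two_of_monic_of_irreducible`
  (**monic irreducible polynomials over a model `k` of `T_exp` have degree `≤ 2`**), by transfer from `ℝ`
  (`Irreducible.natDegree_le_two`) of the first-order sentences "every monic polynomial of degree
  `e + 2` has a monic quadratic factor" (`quadFactorFormula e`), one for each `e`;
* `Literature.ModelTheory.ExponentialFields.RealExpModel.mem_range_of_isAlgebraic` (**a model `k` of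
  `T_exp` is relatively algebraically closed in every model `K ⊇ k`**): an element of `K`
  algebraic over `k` lies in `k` (a monic irreducible quadratic `X² + bX + c` over `k` has
  `c - b²/4 > 0`, as `k` has square roots of non-negative elements, so it has no root in the
  ordered field `K`);
* `Literature.ModelTheory.ExponentialFields.Wilkie1989_polynomialPoints_mem` (**`P_{0,s}`, as a named
  statement**) and `Literature.ModelTheory.ExponentialFields.Wilkie1989_polynomialPoints_mem_holds`
  (**proved**): for models `f : k ↪ K` of `T_exp`, every non-singular zero `ᾱ ∈ Kⁿ` of a square
  system of polynomials with coefficients in `k` lies in `kⁿ`.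

## Mathlib search

Mathlib has `Derivation`, `MvPolynomial.pderiv`, `Derivation.map_aeval` (one variable only),
`minpoly`, `Irreducible.natDegree_le_two` (for `ℝ[X]`) and
`Polynomial.IsMonicOfDegree.eq_isMonicOfDegree_two_mul_isMonicOfDegree`,
`Matrix.eq_zero_of_mulVec_eq_zero`, `Polynomial.funext`, and the class `IsRealClosed` (no theory
of algebraic extensions of real closed fields: we grep'd `IsRealClosed` — only
`FieldTheory/IsRealClosed/Basic.lean`); `FirstOrder.Field.genericMonicPoly` is for `Language.ring`
only.  From the tree: the extension of derivations
(`Literature/NumberTheory/Transcendental/DerivationExtension.lean`), the chain rule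
`derivation_mvPolynomial_aeval` (`KirbyEDerivations.lean`), term powers `ExpPolyCode.powTerm` with
`ExpPolyCode.realize_powTerm_lawful` (`ExpPolyCodeLawful.lean`), transfer of formulas
(`RealExpTransfer.lean`).

## Design choices

* "`g ∈ k[x̄]`" is rendered by Mathlib's `MvPolynomial (Fin n) k`, evaluated in `K` through the
  embedding `f` (`MvPolynomial.eval₂ (RealExpModel.toRingHom f)`); the Jacobian is the matrix of
  the `MvPolynomial.pderiv`.  The identification of Wilkie's height-`0` term functions with
  polynomials is left to the file assembling §6.
* Real-closedness of `k` is not used as such: only the two first-order consequences of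
  `k ≡ ℝ` that the argument needs (quadratic factors; square roots, `RealExpModels.lean`).

## References

* A. J. Wilkie, *On the theory of the real exponential field*, Illinois J. Math. 33 (1989),
  384–408: §6, p. 403 (the statements `P_{j,s}` and the case `j = 0`); p. 395 (height).
-/

noncomputable section

open FirstOrder FirstOrder.Language FirstOrder.Language.Structure
open Polynomial

namespace Literature.ModelTheory.ExponentialFields

/-! ### Non-singular zeros of polynomial systems have algebraic coordinates -/

section Algebraic

variable {k K : Type*} [Field k] [Field K] [Algebra k K]

/-- **The coordinates of a non-singular zero of a square polynomial system are algebraic**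
(characteristic `0`): if `P₁, …, Pₙ ∈ k[X₁, …, Xₙ]` all vanish at `ᾱ ∈ Kⁿ` and the Jacobian
`det (∂Pᵢ/∂Xⱼ(ᾱ))` is nonzero, then each `αⱼ` is algebraic over `k` ("it is well known that the
coordinates of an `ᾱ ∈ Vⁿˢ(g₁, …, gₙ)`, where `g₁, …, gₙ ∈ k[x̄]`, are algebraic over `k`",
Wilkie 1989, p. 403). [folklore] -/
theorem isAlgebraic_of_isNonsingularZero [CharZero k] {n : ℕ} (P : Fin n → MvPolynomial (Fin n) k)
    (α : Fin n → K) (hzero : ∀ i, MvPolynomial.aeval α (P i) = 0)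
    (hdet : (Matrix.of fun i j => MvPolynomial.aeval α (MvPolynomial.pderiv j (P i))).det ≠ 0)
    (j : Fin n) : IsAlgebraic k (α j) := by
  by_contra htr
  obtain ⟨D, hD⟩ :=
    Literature.NumberTheory.Transcendental.exists_derivation_eq_one_of_transcendental htr
  have hmul : (Matrix.of fun i j => MvPolynomial.aeval α (MvPolynomial.pderiv j (P i))).mulVec
      (fun j => D (α j)) = 0 := by
    funext i
    have h := congrArg D (hzero i)
    rw [map_zero, Literature.NumberTheory.Transcendental.derivation_mvPolynomial_aeval] at h
    simpa [Matrix.mulVec, dotProduct, smul_eq_mul] using h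
  have hv := Matrix.eq_zero_of_mulVec_eq_zero hdet hmul
  have := congrFun hv j
  simp [hD] at this

end Algebraic

/-! ### Generic monic polynomials as terms; the quadratic-factor sentences -/

namespace ExpTerm

variable {α : Type*}

/-- The **generic monic polynomial** `xᵈ + Σ_{i<d} cᵢ xⁱ` as a term, with coefficient terms `cᵢ`
and argument term `x`. [folklore] -/
def monicPoly {d : ℕ} (c : Fin d → Language.orderedExpRing.Term α)
    (x : Language.orderedExpRing.Term α) : Language.orderedExpRing.Term α :=
  ExpPolyCode.powTerm x d + sum fun i => c i * ExpPolyCode.powTerm x i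

/-- Realization of `ExpTerm.monicPoly`. [folklore] -/
@[simp] theorem realize_monicPoly {M : Type*} [Language.orderedExpRing.Structure M] [Field M]
    [LinearOrder M] [RealExpModel.LawfulStructure M] (v : α → M) {d : ℕ}
    (c : Fin d → Language.orderedExpRing.Term α) (x : Language.orderedExpRing.Term α) :
    (monicPoly c x).realize v = x.realize v ^ d + ∑ i : Fin d, (c i).realize v * x.realize v ^ (i : ℕ) := by
  simp [monicPoly]

end ExpTerm

namespace RealExpModel

/-- **"Every monic polynomial of degree `e + 2` has a monic quadratic factor"** as a first-order
formula in the `e + 2` free variables `c₀, …, cₑ₊₁` (the coefficients):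
`∃ q₀ q₁ r₀ … rₑ₋₁ ∀ x, x^{e+2} + Σ cᵢ xⁱ = (x² + q₁ x + q₀) · (xᵉ + Σ rᵢ xⁱ)`. [folklore] -/
def quadFactorFormula (e : ℕ) : Language.orderedExpRing.Formula (Fin (e + 2)) :=
  Formula.iExs (Fin 2 ⊕ Fin e)
    (Formula.iAlls (Fin 1)
      (ExpFormula.eq
        (ExpTerm.monicPoly (fun i : Fin (e + 2) => var (Sum.inl (Sum.inl i))) (var (Sum.inr 0)))
        (ExpTerm.monicPoly (fun i : Fin 2 => var (Sum.inl (Sum.inr (Sum.inl i)))) (var (Sum.inr 0)) *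
          ExpTerm.monicPoly (fun i : Fin e => var (Sum.inl (Sum.inr (Sum.inr i)))) (var (Sum.inr 0)))))

/-- Realization of `quadFactorFormula` in a lawful structure. [folklore] -/
theorem realize_quadFactorFormula {M : Type*} [Language.orderedExpRing.Structure M] [Field M]
    [LinearOrder M] [LawfulStructure M] (e : ℕ) (v : Fin (e + 2) → M) :
    (quadFactorFormula e).Realize v ↔
      ∃ (q : Fin 2 → M) (r : Fin e → M), ∀ x : M,
        x ^ (e + 2) + ∑ i : Fin (e + 2), v i * x ^ (i : ℕ) =
          (x ^ 2 + ∑ i : Fin 2, q i * x ^ (i : ℕ)) * (x ^ e + ∑ i : Fin e, r i * x ^ (i : ℕ)) := by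
  simp only [quadFactorFormula, Formula.realize_iExs, Formula.realize_iAlls, ExpFormula.realize_eq,
    ExpTerm.realize_monicPoly, ExpTerm.realize_mul, Term.realize_var, Sum.elim_inl, Sum.elim_inr]
  constructor
  · rintro ⟨w, hw⟩
    exact ⟨fun i => w (Sum.inl i), fun i => w (Sum.inr i), fun x => hw fun _ => x⟩
  · rintro ⟨q, r, h⟩
    refine ⟨Sum.elim q r, fun x => ?_⟩
    simpa using h (x 0)

/-! ### Monic polynomials from coefficient vectors -/

/-- The monic polynomial `Xᵈ + Σ_{i<d} vᵢ Xⁱ` with coefficient vector `v`. [folklore] -/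
def ofCoeffs {R : Type*} [CommRing R] {d : ℕ} (v : Fin d → R) : R[X] :=
  X ^ d + ∑ i : Fin d, C (v i) * X ^ (i : ℕ)

/-- Evaluation of `ofCoeffs v`. [folklore] -/
theorem eval_ofCoeffs {R : Type*} [CommRing R] {d : ℕ} (v : Fin d → R) (x : R) :
    (ofCoeffs v).eval x = x ^ d + ∑ i : Fin d, v i * x ^ (i : ℕ) := by
  simp [ofCoeffs, eval_finsetSum]

/-- `ofCoeffs v` is monic of degree `d`. [folklore] -/
theorem isMonicOfDegree_ofCoeffs {R : Type*} [CommRing R] [Nontrivial R] {d : ℕ} (v : Fin d → R) :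
    IsMonicOfDegree (ofCoeffs v) d := by
  rcases Nat.eq_zero_or_pos d with rfl | hd
  · rw [isMonicOfDegree_zero_iff]
    simp [ofCoeffs]
  · refine (isMonicOfDegree_X_pow R d).add_right ?_
    refine lt_of_le_of_lt (natDegree_sum_le_of_forall_le _ _ (n := d - 1) fun i _ => ?_) (by omega)
    exact (natDegree_C_mul_X_pow_le (v i) i).trans (by have := i.2; omega)

/-- A monic polynomial of degree `d` is `ofCoeffs` of its first `d` coefficients. [folklore] -/
theorem eq_ofCoeffs_of_isMonicOfDegree {R : Type*} [CommRing R] {d : ℕ} {p : R[X]}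
    (hp : IsMonicOfDegree p d) : p = ofCoeffs fun i : Fin d => p.coeff i := by
  conv_lhs => rw [hp.monic.as_sum, hp.natDegree_eq]
  rw [ofCoeffs, Finset.sum_range (fun i => C (p.coeff i) * X ^ i)]

/-- Evaluation of a monic polynomial of degree `d` through its coefficients. [folklore] -/
theorem eval_eq_of_isMonicOfDegree {R : Type*} [CommRing R] {d : ℕ} {p : R[X]}
    (hp : IsMonicOfDegree p d) (x : R) :
    p.eval x = x ^ d + ∑ i : Fin d, p.coeff i * x ^ (i : ℕ) := by
  conv_lhs => rw [eq_ofCoeffs_of_isMonicOfDegree hp]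
  exact eval_ofCoeffs _ x

/-! ### The quadratic-factor sentences hold in `ℝ`, hence in every model of `T_exp` -/

/-- **Every monic real polynomial of degree `e + 2` has a monic quadratic factor** (from
`Irreducible.natDegree_le_two`, via Mathlib's
`Polynomial.IsMonicOfDegree.eq_isMonicOfDegree_two_mul_isMonicOfDegree`), in the first-order form
`quadFactorFormula`. [folklore] -/
theorem realize_quadFactorFormula_real (e : ℕ) (v : Fin (e + 2) → ℝ) :
    (quadFactorFormula e).Realize v := by
  rw [realize_quadFactorFormula]
  obtain ⟨f₁, f₂, h₁, h₂, h⟩ := (isMonicOfDegree_ofCoeffs v).eq_isMonicOfDegree_two_mul_isMonicOfDegree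
  refine ⟨fun i => f₁.coeff i, fun i => f₂.coeff i, fun x => ?_⟩
  have hx := congrArg (Polynomial.eval x) h
  rwa [eval_ofCoeffs, eval_mul, eval_eq_of_isMonicOfDegree h₁, eval_eq_of_isMonicOfDegree h₂] at hx

variable {k K : Language.Theory.ModelType.{0, 0, 0} realExpTheory}

/-- **Transfer**: in a model `k` of `T_exp`, every monic polynomial function of degree `e + 2`
factors as a monic quadratic times a monic polynomial function of degree `e`. [folklore] -/
theorem exists_quadFactor (e : ℕ) (v : Fin (e + 2) → k) :
    ∃ (q : Fin 2 → k) (r : Fin e → k), ∀ x : k,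
      x ^ (e + 2) + ∑ i : Fin (e + 2), v i * x ^ (i : ℕ) =
        (x ^ 2 + ∑ i : Fin 2, q i * x ^ (i : ℕ)) * (x ^ e + ∑ i : Fin e, r i * x ^ (i : ℕ)) :=
  (realize_quadFactorFormula e v).1
    (realize_formula_of_real k (quadFactorFormula e) (realize_quadFactorFormula_real e) v)

/-- **Irreducible polynomials over a model of `T_exp` have degree at most `2`** (monic case;
transfer of the real fact `Irreducible.natDegree_le_two`). [folklore] -/
theorem natDegree_le_two_of_monic_of_irreducible {m : k[X]} (hmo : m.Monic) (hm : Irreducible m) :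
    m.natDegree ≤ 2 := by
  by_contra hlt
  obtain ⟨e, he⟩ : ∃ e, m.natDegree = (e + 1) + 2 := ⟨m.natDegree - 3, by omega⟩
  have hmd : IsMonicOfDegree m ((e + 1) + 2) := ⟨he, hmo⟩
  obtain ⟨q, r, hqr⟩ := exists_quadFactor (e + 1) (fun i => m.coeff i)
  -- `m = Q * R` as polynomials, by comparing the polynomial functions on the infinite field `k`
  have hfac : m = ofCoeffs q * ofCoeffs r := by
    refine Polynomial.funext fun x => ?_
    rw [eval_eq_of_isMonicOfDegree hmd, eval_mul, eval_ofCoeffs, eval_ofCoeffs]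
    exact hqr x
  have hQ : IsMonicOfDegree (ofCoeffs q) 2 := isMonicOfDegree_ofCoeffs q
  have hR : IsMonicOfDegree (ofCoeffs r) (e + 1) := isMonicOfDegree_ofCoeffs r
  rcases hm.isUnit_or_isUnit hfac with hu | hu
  · have := natDegree_eq_zero_of_isUnit hu
    rw [hQ.natDegree_eq] at this
    exact absurd this (by norm_num)
  · have := natDegree_eq_zero_of_isUnit hu
    rw [hR.natDegree_eq] at this
    exact absurd this (by omega)

/-- A monic irreducible quadratic `X² + bX + c` over a model `k` of `T_exp` has `b²/4 < c`
(otherwise `-b/2 + √(b²/4 - c)` is a root in `k`, which has square roots of non-negative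
elements). [folklore] -/
theorem discr_neg_of_irreducible {b c : k} (hm : Irreducible (X ^ 2 + C b * X + C c)) :
    b ^ 2 / 4 < c := by
  by_contra hle
  rw [not_lt] at hle
  obtain ⟨s, hs⟩ := exists_mul_self_eq (sub_nonneg.2 hle)
  -- `-b/2 + s` is a root
  have hroot : (X ^ 2 + C b * X + C c).IsRoot (-b / 2 + s) := by
    simp only [IsRoot.def, eval_add, eval_pow, eval_X, eval_mul, eval_C]
    linear_combination hs
  have h1 := degree_eq_one_of_irreducible_of_root hm hroot
  have h2 : (X ^ 2 + C b * X + C c).degree = 2 := by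
    compute_degree!
  rw [h2] at h1
  exact absurd h1 (by decide)

/-- **A model `k` of `T_exp` is relatively algebraically closed in every model `K ⊇ k`**: an element
of `K` annihilated by a nonzero polynomial with coefficients in `k` (through the embedding `f`)
lies in (the image of) `k` ("`k`, `K` are real-closed fields (being models of `Tₑ`)", Wilkie
1989, p. 403). [folklore] -/
theorem mem_range_of_isAlgebraic (f : k ↪[Language.orderedExpRing] K) {a : K} {p : k[X]}
    (hp0 : p ≠ 0) (hpa : p.eval₂ (toRingHom f) a = 0) : a ∈ Set.range f := by
  letI : Algebra k K := (toRingHom f).toAlgebra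
  have hφ : ∀ x : k, algebraMap k K x = f x := fun x => rfl
  have ha : IsAlgebraic k a := ⟨p, hp0, hpa⟩
  have hint : IsIntegral k a := ha.isIntegral
  have hirr := minpoly.irreducible hint
  have hmo := minpoly.monic hint
  have hdeg := natDegree_le_two_of_monic_of_irreducible hmo hirr
  have hpos := minpoly.natDegree_pos hint
  have haev : aeval a (minpoly k a) = 0 := minpoly.aeval k a
  rcases Nat.lt_or_ge (minpoly k a).natDegree 2 with hlt | hge
  · -- degree `1`: `minpoly = X + C r`, so `a = f (-r)`
    have h1 : IsMonicOfDegree (minpoly k a) 1 := ⟨by omega, hmo⟩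
    obtain ⟨r, hr⟩ := isMonicOfDegree_one_iff.1 h1
    rw [hr, aeval_def] at haev
    simp only [eval₂_add, eval₂_X, eval₂_C, hφ] at haev
    exact ⟨-r, by rw [map_neg]; linear_combination -haev⟩
  · -- degree `2`: `minpoly = X² + C b X + C c` with `b²/4 < c`: no root in the ordered field `K`
    exfalso
    have h2 : IsMonicOfDegree (minpoly k a) 2 := ⟨le_antisymm hdeg hge, hmo⟩
    obtain ⟨b, c, hbc⟩ := isMonicOfDegree_two_iff.1 h2
    have hdisc : b ^ 2 / 4 < c := discr_neg_of_irreducible (hbc ▸ hirr)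
    rw [hbc, aeval_def] at haev
    simp only [eval₂_add, eval₂_mul, eval₂_pow, eval₂_X, eval₂_C, hφ] at haev
    have hK : f (b ^ 2 / 4) < f c := (map_lt_iff f _ _).2 hdisc
    have hK' : f (b ^ 2 / 4) = f b ^ 2 / 4 := by
      have h4 := map_div₀ (toRingHom f) (b ^ 2) 4
      rw [map_pow, map_ofNat, coe_toRingHom] at h4
      exact h4
    rw [hK'] at hK
    nlinarith [sq_nonneg (a + f b / 2)]

end RealExpModel

/-! ### `P_{0,s}`: non-singular zeros of polynomial systems over `k` lie in `kⁿ` -/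

/-- **Wilkie 1989, §6, `P_{0,s}`** (p. 403): "Suppose `n ∈ ℕ`, `n ≥ 1`, `ᾱ ∈ Kⁿ`, … and
`M ⊆ k[x̄]ᵉ` has height `≤ 0`" — i.e. `g₁, …, gₙ ∈ k[x̄]` are polynomials — "If
`ᾱ ∈ Vⁿˢ(g₁, …, gₙ)` then `ᾱ ∈ kⁿ`": for models `f : k ↪ K` of `T_exp`, a common zero `ᾱ ∈ Kⁿ` of
polynomials `P₁, …, Pₙ` with coefficients in `k` at which the Jacobian determinant
`det (∂Pᵢ/∂Xⱼ(ᾱ))` is nonzero lies in `kⁿ` ("`P_{0,s}` is clear since it is well known that the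
coordinates of an `ᾱ ∈ Vⁿˢ(g₁, …, gₙ)`, where `g₁, …, gₙ ∈ k[x̄]`, are algebraic over `k`, and `k`,
`K` are real-closed fields").  Proved below (`Wilkie1989_polynomialPoints_mem_holds`). [cite: Wilkie1989, §6, p. 403] -/
def Wilkie1989_polynomialPoints_mem : Prop :=
  ∀ (k K : Language.Theory.ModelType.{0, 0, 0} realExpTheory) (f : k ↪[Language.orderedExpRing] K)
    (n : ℕ) (P : Fin n → MvPolynomial (Fin n) k) (α : Fin n → K),
    (∀ i, MvPolynomial.eval₂ (RealExpModel.toRingHom f) α (P i) = 0) →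
      (Matrix.of fun i j =>
          MvPolynomial.eval₂ (RealExpModel.toRingHom f) α (MvPolynomial.pderiv j (P i))).det ≠ 0 →
        ∃ β : Fin n → k, f ∘ β = α

/-- **Wilkie 1989, §6, `P_{0,s}`: proved** (derivations for algebraicity,
`isAlgebraic_of_isNonsingularZero`; relative algebraic closedness of `k` in `K`,
`RealExpModel.mem_range_of_isAlgebraic`). [cite: Wilkie1989, §6, p. 403] -/
theorem Wilkie1989_polynomialPoints_mem_holds : Wilkie1989_polynomialPoints_mem := by
  intro k K f n P α hzero hdet
  letI : Algebra k K := (RealExpModel.toRingHom f).toAlgebra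
  have halg : ∀ j, IsAlgebraic k (α j) :=
    isAlgebraic_of_isNonsingularZero P α hzero hdet
  have hmem : ∀ j, α j ∈ Set.range f := fun j => by
    obtain ⟨p, hp0, hpa⟩ := halg j
    exact RealExpModel.mem_range_of_isAlgebraic f hp0 hpa
  choose β hβ using hmem
  exact ⟨β, funext hβ⟩

end Literature.ModelTheory.ExponentialFields
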